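import Literature.Analysis.FluidPDE.DEIJCascade
import Literature.Analysis.FluidPDE.BrueDeLellisAnomalousDissipation
import Literature.Analysis.FluidPDE.CheskidovGluedCalculus
import HarnessLib

/-!
# Regularity of the DEIJ cascade velocity: `C⁰_t C^α_x` on `[0,T)`, `L¹_t C^α_x`, `L^∞`

Proof-support file for the discharge of `deij_anomalous_dissipation_eventually`
(`TurbPassiveScalar`), continuing `DEIJCascade`: the regularity clauses of
[cite: DrivasEtAl2022, Theorem 2] for the cascade velocity `DEIJ.CascadeData.u`. Everything is
proved; the only definition is the stage Hölder budget `Hst α k = 1 + (√d d N_k)^α 2^{1-α}`.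

* `norm_partialDeriv_drift_le_of_slope`, `eBoundedHolderNorm_drift_le_linear`: the `C^{0,r}` norm of a shear drift
  `b φ(x_q) e_p` with `|φ| ≤ 1`, `|φ'| ≤ L` is at most `|b|(1 + (√d d L)^r 2^{1-r})`
  (interpolation `Gluing.eBoundedHolderNorm_le_interp`);
* `continuousInHolderOn_u`: `u ∈ C⁰([0,T); C^{0,α})` for `α < 1` (locally jointly smooth up to a
  later time; `BrueDeLellis2023.continuousInHolderOn_of_isSmoothSpaceTimeOn`);
* `memLpHolder_u`: `u ∈ L¹((0,T); C^{0,α})` when `α(m+1) < m`, the stage budgets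
  `2C_ψ H_k t_k` being summable (`(2r)^α < r`);
* `memLp_top_stLift_u`: `u` is bounded (by `2C_ψ`) in space–time.

## References

* [DrivasEtAl2022] T. D. Drivas, T. M. Elgindi, G. Iyer, I.-J. Jeong, *Anomalous dissipation in
  passive scalar transport*, Arch. Ration. Mech. Anal. 243 (2022), arXiv:1911.03271, Theorem 2,
  Remark 3.1.
-/

noncomputable section

open MeasureTheory TopologicalSpace Set Function Filter Topology UnitAddTorus
open scoped ENNReal NNReal InnerProductSpace ContDiff
open Literature.Analysis.FunctionSpaces
open Literature.Analysis.FunctionSpaces.Torus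
open Literature.Analysis.FunctionSpaces.Torus renaming partialDeriv → tPartialDeriv

namespace Literature.Analysis.FluidPDE

namespace Torus

namespace DEIJ

variable {d : Type*} [Fintype d] [DecidableEq d]

/-! ## Spatial derivatives and Hölder norms of a shear drift -/

/-- **The spatial derivatives of a shear drift are bounded by the slope of its profile**:
`‖∂ᵢ((b φ(x_q)) e_p)‖ ≤ |b| sup|φ'|`. [folklore] -/
theorem norm_partialDeriv_drift_le_of_slope {p q : d} (P : ShearProfile) {K₁ : ℝ} (hK₁ : ∀ t, |deriv P t| ≤ K₁) (b : ℝ)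
    (i : d) (x : UnitAddTorus d) : ‖tPartialDeriv i (drift p q P b) x‖ ≤ |b| * K₁ := by
  have hK0 : 0 ≤ K₁ := (abs_nonneg _).trans (hK₁ 0)
  obtain ⟨y, hy⟩ := QuotientAddGroup.mk_surjective (x q)
  unfold FunctionSpaces.Torus.partialDeriv FunctionSpaces.Torus.lineDeriv
  by_cases hi : i = q
  · subst hi
    have e : (fun t : ℝ => drift p i P b (x + proj (t • EuclideanSpace.single i (1 : ℝ)))) =
        fun t => (b * P (y + t)) • EuclideanSpace.single p (1 : ℝ) := by
      funext t
      rw [drift_apply]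
      have h1 : (x + proj (t • EuclideanSpace.single i (1 : ℝ))) i = ((y + t : ℝ) : UnitAddCircle) := by
        rw [Pi.add_apply, proj_apply, ← hy]; simp
      rw [h1, ShearProfile.onCircle_coe]
    rw [e]
    have hP : HasDerivAt P (deriv P y) (y + 0) := by
      rw [add_zero]; exact ((P.contDiff.differentiable (by simp)).differentiableAt).hasDerivAt
    have h2 : HasDerivAt (fun t : ℝ => (b * P (y + t)) • EuclideanSpace.single p (1 : ℝ))
        ((b * deriv P y) • EuclideanSpace.single p (1 : ℝ)) 0 :=
      ((hP.comp_const_add y 0).const_mul b).smul_const _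
    rw [h2.deriv, norm_smul, PiLp.norm_single, norm_one, mul_one, Real.norm_eq_abs, abs_mul]
    exact mul_le_mul_of_nonneg_left (hK₁ y) (abs_nonneg _)
  · have e : (fun t : ℝ => drift p q P b (x + proj (t • EuclideanSpace.single i (1 : ℝ)))) = fun _ => drift p q P b x := by
      funext t
      rw [drift_apply, drift_apply]
      have h1 : (x + proj (t • EuclideanSpace.single i (1 : ℝ))) q = x q := by
        rw [Pi.add_apply, proj_apply]; simp [Ne.symm hi]
      rw [h1]
    rw [e, deriv_const, norm_zero]
    positivity

/-- **The `C^{0,r}` norm of a shear drift** with `|φ| ≤ 1`, `|φ'| ≤ L` (`L ≥ 0`, `r ≤ 1`):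
`‖b φ(x_q) e_p‖_{C^{0,r}} ≤ |b| (1 + (√d d L)^r 2^{1-r})`. [folklore] -/
theorem eBoundedHolderNorm_drift_le_linear {p q : d} (P : ShearProfile) (hP0 : ∀ t, |P t| ≤ 1) {L : ℝ} (hL : 0 ≤ L)
    (hP1 : ∀ t, |deriv P t| ≤ L) {r : ℝ≥0} (hr : r ≤ 1) (b : ℝ) :
    eBoundedHolderNorm r (drift p q P b) ≤
      ENNReal.ofReal (|b| * (1 + (Real.sqrt (Fintype.card d) * (Fintype.card d * L)) ^ (r : ℝ) * 2 ^ (1 - (r : ℝ)))) := by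
  have e : drift p q P b = b • drift p q P 1 := by
    funext x; simp [drift_apply, smul_smul]
  have h' : eBoundedHolderNorm r (drift p q P 1) ≤
      ENNReal.ofReal (1 + (Real.sqrt (Fintype.card d) * (Fintype.card d * L)) ^ (r : ℝ) * 2 ^ (1 - (r : ℝ))) := by
    have h := Gluing.eBoundedHolderNorm_le_interp (g := drift p q P 1) ((isSmooth_drift p q P 1).isContDiff (by simp)) hr
      zero_le_one hL (fun x => by have := norm_drift_le p q hP0 1 x; simpa using this)
      (fun i x => by have := norm_partialDeriv_drift_le_of_slope (p := p) (q := q) P hP1 1 i x; simpa using this)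
    simpa using h
  rw [e, eBoundedHolderNorm_const_smul, Real.enorm_eq_ofReal_abs, ENNReal.ofReal_mul (abs_nonneg b)]
  gcongr

namespace CascadeData

variable (D : CascadeData d)

/-! ## Continuity in the Hölder norm -/

/-- **The cascade velocity is continuous in `C^{0,α}(T^d)` on `[0, T)`** for every `α < 1`
(locally it is jointly smooth up to a slightly later time). [cite: DrivasEtAl2022, Theorem 2] -/
theorem continuousInHolderOn_u {α : ℝ≥0} (hα : α < 1) : ContinuousInHolderOn (Ico 0 D.T) α D.u := by
  have key : ∀ t₀ ∈ Ico 0 D.T, ∃ b, t₀ < b ∧ b < D.T ∧ ContinuousInHolderOn (Icc 0 b) α D.u := by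
    intro t₀ ht₀
    refine ⟨(t₀ + D.T) / 2, by linarith [ht₀.2], by linarith [ht₀.2], ?_⟩
    refine BrueDeLellis2023.continuousInHolderOn_of_isSmoothSpaceTimeOn (by linarith [ht₀.1, ht₀.2]) ?_ hα
    exact D.isSmoothSpaceTimeOn_u_Iio.mono fun t ht => lt_of_le_of_lt ht.2 (by linarith [ht₀.2])
  refine ⟨fun t ht => ?_, fun t₀ ht₀ => ?_⟩
  · obtain ⟨b, hb1, -, h⟩ := key t ht
    exact h.1 t ⟨ht.1, hb1.le⟩
  · obtain ⟨b, hb1, -, h⟩ := key t₀ ht₀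
    have h2 := h.2 t₀ ⟨ht₀.1, hb1.le⟩
    have hle : 𝓝[Ico 0 D.T] t₀ ≤ 𝓝[Icc 0 b] t₀ := by
      rw [nhdsWithin_restrict' (Ico 0 D.T) (Iio_mem_nhds hb1)]
      exact nhdsWithin_mono _ fun t ht => ⟨ht.1.1, le_of_lt ht.2⟩
    exact h2.mono_left hle

/-! ## The `L¹_t C^{0,α}_x` bound -/

/-- The Hölder constant `H_k = 1 + (√d d N_k)^α 2^{1-α}` of stage `k`. [folklore] -/
def Hst (α : ℝ≥0) (k : ℕ) : ℝ :=
  1 + (Real.sqrt (Fintype.card d) * (Fintype.card d * D.Nf k)) ^ (α : ℝ) * 2 ^ (1 - (α : ℝ))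

/-- `Hst_pos` (Hst pos). [folklore] -/
theorem Hst_pos (α : ℝ≥0) (k : ℕ) : 0 < D.Hst α k := by
  unfold Hst; positivity

/-- **The `C^{0,α}` norm of the stage velocity**: `‖U_k(t)‖_{C^{0,α}} ≤ |A_k'(t)| H_k ≤ 2C_ψ H_k`. [folklore] -/
theorem eBoundedHolderNorm_U_le {α : ℝ≥0} (hα : α ≤ 1) (k : ℕ) (t : ℝ) :
    eBoundedHolderNorm α (D.U k t) ≤ ENNReal.ofReal (2 * ShearCascade.Cψ1 * D.Hst α k) := by
  unfold U
  refine (eBoundedHolderNorm_drift_le_linear (D.P k) (fun y => D.abs_prof_le k _ y) (Nat.cast_nonneg (D.Nf k))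
    (fun y => D.abs_deriv_prof_le k _ y) hα _).trans ?_
  refine ENNReal.ofReal_le_ofReal ?_
  unfold Hst
  exact mul_le_mul_of_nonneg_right (D.abs_deriv_A_le k t) (D.Hst_pos α k).le

/-- The summability exponent: `(2r)^α/r < 1` when `α(m+1) < m`. [folklore] -/
theorem ratio_lt_one {α : ℝ≥0} (hαm : (α : ℝ) * (D.m + 1) < D.m) : (2 * D.r) ^ (α : ℝ) / D.r < 1 := by
  have hr := D.r_pos
  rw [div_lt_one hr]
  unfold r at *
  have e : (2 : ℝ) * 2 ^ D.m = 2 ^ ((D.m : ℝ) + 1) := by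
    rw [Real.rpow_add two_pos, Real.rpow_natCast, Real.rpow_one]; ring
  rw [e, ← Real.rpow_mul two_pos.le]
  calc (2 : ℝ) ^ (((D.m : ℝ) + 1) * α) < 2 ^ (D.m : ℝ) :=
        Real.rpow_lt_rpow_of_exponent_lt one_lt_two (by rw [mul_comm]; exact hαm)
    _ = 2 ^ D.m := Real.rpow_natCast 2 D.m

/-- `N_k^α t_k = T(r-1)N₀^α ((2r)^α/r)^{k+1}`. [folklore] -/
theorem rpow_Nf_mul_dur (α : ℝ≥0) (k : ℕ) :
    (D.Nf k : ℝ) ^ (α : ℝ) * D.dur k = D.T * (D.r - 1) * (D.N₀ : ℝ) ^ (α : ℝ) * ((2 * D.r) ^ (α : ℝ) / D.r) ^ (k + 1) := by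
  have hr := D.r_pos
  have hN := D.N₀_pos
  rw [cast_Nf, Real.mul_rpow hN.le (by positivity), div_pow, ← Real.rpow_natCast ((2 * D.r) ^ (α : ℝ)),
    ← Real.rpow_mul (by positivity), mul_comm (α : ℝ) ((k + 1 : ℕ) : ℝ), Real.rpow_mul (by positivity),
    Real.rpow_natCast]
  unfold dur
  field_simp

/-- **Summability of the stage Hölder budgets**: `Σ_k H_k t_k < ∞` when `α(m+1) < m`. [folklore] -/
theorem summable_Hst_mul_dur {α : ℝ≥0} (hαm : (α : ℝ) * (D.m + 1) < D.m) :
    Summable fun k => D.Hst α k * D.dur k := by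
  have hr := D.r_pos
  have hq0 : 0 ≤ (2 * D.r) ^ (α : ℝ) / D.r := by positivity
  have hq1 := D.ratio_lt_one hαm
  -- `t_k` is geometric
  have hdur : Summable fun k => D.dur k := by
    have h : ∀ k, D.dur k = D.T * (D.r - 1) / D.r * (1 / D.r) ^ k := fun k => by
      unfold dur; rw [pow_succ, one_div_pow]; field_simp
    simp_rw [h]
    refine Summable.mul_left _ (summable_geometric_of_lt_one (by positivity) ?_)
    rw [div_lt_one hr]; linarith [D.two_le_r]
  -- `N_k^α t_k` is geometric
  have hN : Summable fun k => (D.Nf k : ℝ) ^ (α : ℝ) * D.dur k := by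
    simp_rw [D.rpow_Nf_mul_dur α]
    refine Summable.mul_left _ ?_
    have h := (summable_geometric_of_lt_one hq0 hq1).mul_left ((2 * D.r) ^ (α : ℝ) / D.r)
    refine h.congr fun k => ?_
    rw [pow_succ]; ring
  have e : ∀ k, D.Hst α k * D.dur k =
      D.dur k + (Real.sqrt (Fintype.card d) * Fintype.card d) ^ (α : ℝ) * 2 ^ (1 - (α : ℝ)) *
        ((D.Nf k : ℝ) ^ (α : ℝ) * D.dur k) := by
    intro k
    unfold Hst
    rw [← mul_assoc (Real.sqrt _), Real.mul_rpow (by positivity) (Nat.cast_nonneg _)]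
    ring
  simp_rw [e]
  exact hdur.add (hN.mul_left _)

/-- **The cascade velocity is in `L¹_t C^{0,α}_x` on `(0,T)`** when `α < 1` and `α(m+1) < m`.
[cite: DrivasEtAl2022, Theorem 2] -/
theorem memLpHolder_u {α : ℝ≥0} (hα : α < 1) (hαm : (α : ℝ) * (D.m + 1) < D.m) : MemLpHolder 1 α D.u (Ioo 0 D.T) := by
  have hcont := D.continuousInHolderOn_u hα
  refine ⟨?_, ?_⟩
  · exact (ae_restrict_iff' measurableSet_Ioo).2 (Eventually.of_forall fun t ht => hcont.1 t ⟨ht.1.le, ht.2⟩)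
  · -- bound the `L¹` norm by the sum of the stage budgets
    unfold eLpHolderNorm
    rw [eLpNorm_one_eq_lintegral_enorm]
    have hcover : Ioo 0 D.T ⊆ ⋃ k, Ico (D.Tst k) (D.Tst (k + 1)) := by
      intro t ht
      refine mem_iUnion.2 ⟨D.idx t, ?_, D.lt_Tst_idx_succ ht.2⟩
      rcases eq_or_ne (D.idx t) 0 with h | h
      · rw [h, Tst_zero]; exact ht.1.le
      · exact D.Tst_idx_le ht.2 h
    refine lt_of_le_of_lt (lintegral_mono_set hcover) ?_
    refine lt_of_le_of_lt (lintegral_iUnion_le _ _) ?_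
    -- each stage: `∫_{stage k} ‖u t‖_{C^α} ≤ 2 C_ψ H_k t_k`
    have hstage : ∀ k, ∫⁻ t in Ico (D.Tst k) (D.Tst (k + 1)), ‖boundedHolderNorm α (D.u t)‖ₑ ≤
        ENNReal.ofReal (2 * ShearCascade.Cψ1 * D.Hst α k * D.dur k) := by
      intro k
      have hb : ∀ t ∈ Ico (D.Tst k) (D.Tst (k + 1)), ‖boundedHolderNorm α (D.u t)‖ₑ ≤
          ENNReal.ofReal (2 * ShearCascade.Cψ1 * D.Hst α k) := by
        intro t ht
        have hT : t < D.T := lt_trans ht.2 (D.Tst_lt_T _)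
        have hk : D.idx t = k := D.idx_eq hT (Or.inr ht.1) ht.2
        have hu : D.u t = D.U k t := by unfold u; rw [hk]
        rw [hu, Real.enorm_eq_ofReal_abs, boundedHolderNorm, abs_of_nonneg ENNReal.toReal_nonneg]
        have h := D.eBoundedHolderNorm_U_le hα.le k t
        calc ENNReal.ofReal (eBoundedHolderNorm α (D.U k t)).toReal ≤ eBoundedHolderNorm α (D.U k t) :=
              ENNReal.ofReal_toReal_le
          _ ≤ _ := h
      calc ∫⁻ t in Ico (D.Tst k) (D.Tst (k + 1)), ‖boundedHolderNorm α (D.u t)‖ₑ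
          ≤ ∫⁻ _ in Ico (D.Tst k) (D.Tst (k + 1)), ENNReal.ofReal (2 * ShearCascade.Cψ1 * D.Hst α k) :=
            setLIntegral_mono' measurableSet_Ico hb
        _ = ENNReal.ofReal (2 * ShearCascade.Cψ1 * D.Hst α k) * volume (Ico (D.Tst k) (D.Tst (k + 1))) :=
            setLIntegral_const _ _
        _ = ENNReal.ofReal (2 * ShearCascade.Cψ1 * D.Hst α k * D.dur k) := by
            rw [Real.volume_Ico, Tst_succ, add_sub_cancel_left, ← ENNReal.ofReal_mul (by
              have := D.Hst_pos α k; have := ShearCascade.Cψ1_spec.1; positivity)]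
    refine lt_of_le_of_lt (ENNReal.tsum_le_tsum hstage) ?_
    have hsum : Summable fun k => 2 * ShearCascade.Cψ1 * D.Hst α k * D.dur k := by
      have h := (D.summable_Hst_mul_dur hαm).mul_left (2 * ShearCascade.Cψ1)
      refine h.congr fun k => ?_; ring
    have hnn : ∀ k, 0 ≤ 2 * ShearCascade.Cψ1 * D.Hst α k * D.dur k := fun k => by
      have := D.Hst_pos α k; have := ShearCascade.Cψ1_spec.1; have := D.dur_pos k; positivity
    rw [← ENNReal.ofReal_tsum_of_nonneg hnn hsum]
    exact ENNReal.ofReal_lt_top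

/-! ## `L^∞` in space–time -/

/-- The space–time lift of the cascade velocity is in `L^∞((0,T) × ℝ^d)`. [folklore] -/
theorem memLp_top_stLift_u :
    MemLp (FunctionSpaces.Torus.stLift D.u) ∞ (volume.restrict (Ioo 0 D.T ×ˢ (univ : Set (EuclideanSpace ℝ d)))) := by
  refine memLp_top_of_bound (D.isSmoothSpaceTimeOn_u_Iio.aestronglyMeasurable_stLift measurableSet_Ioo
    Ioo_subset_Iio_self) (2 * ShearCascade.Cψ1) (Eventually.of_forall fun z => ?_)
  exact D.norm_u_le z.1 (proj z.2)

end CascadeData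

end DEIJ

end Torus

end Literature.Analysis.FluidPDE
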